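import Summits.FinalStateConjecture.FinalStateConjecture.Theorems.BartnikGapSettlingGapExhaustionIKStepKillingTransport
import Summits.FinalStateConjecture.FinalStateConjecture.Theorems.BartnikGapSettlingGapExhaustionMultiplierBelowShell
import Summits.FinalStateConjecture.FinalStateConjecture.Theorems.BartnikGapSettlingGapExhaustionKerrBandHigherRegularity
import Summits.FinalStateConjecture.FinalStateConjecture.Theorems.BartnikGapSettlingGapExhaustionRicAtChartKillingLocality
import Summits.FinalStateConjecture.FinalStateConjecture.Theorems.BartnikGapSettlingGapExhaustionIsMetricOnMetricInCoords
import HarnessLib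

/-!
# Crux `GapExhaustion` (stmt-FinalStateConjecture-10808), line `photon-shell-pseudoconvexity`:
# stub (N-6) `stub_ikLocalStep` — the UNIFORM LOCAL EXTENSION STEP of the outward sweep on a
# Kerr band, from Ionescu–Klainerman's local Killing-extension theorem in chart form

Route `BartnikGapSettling`; helper (`--supports stmt-FinalStateConjecture-10808`) of line lead
c10. The level-set sweep `stub_kerrCoordKillingSweepSmooth` (p131650) globalises a local
extension property `hloc` across the Kerr–Schild cylinders `{r = c}`, `c ∈ [r_lo, r_e]`: every
`C^∞` solution of the coordinate Killing equation of the chart components `G = 𝓢.metricInCoords Φ`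
on `ball x ρ ∩ {r < c}` (`r x = c`) extends to one on `ball x ρ'`, with ONE `ρ'` for the whole
band. This file proves `hloc` for every eternal star chart `C⁶`-close to Kerr on the band
`r₊ < r_lo ≤ r ≤ r_e < r_ph⁺`, CONDITIONALLY on the chart form of Ionescu–Klainerman's theorem
(JAMS 26 (2013), Thm 1.2 with the printed uniformity of Lemmas 2.10–2.11), taken as an explicit
hypothesis (the body of the skeleton's `IKLocalKillingExtension`, verbatim): at a cylinder point
`x` normalise the chart by the affine map `y ↦ x + s L y` with the exact frame `L` of
`stub_ikFrameNormalisation` (N-6a), rescale the components by `s⁻²`, verify IK's hypotheses with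
`stub_ikQuant6` / `ikStep_bound_A` / `ikStep_Gt_basic` / `ikStep_ft_basic` (N-6c: the
quantitative pseudo-convexity is `stub_kerrMultiplierBelowShell`, p128795, at `x`; the smoothness
constant comes from `stub_kerrBandHigherRegularity`, p133219; Ricci-flatness in the chart is
`killingLoc_ricAt_metricInCoords_eq_zero`, p133423), carry the Killing data in and out with
`ikStep_kt_input` / `stub_ikKillingBack` (N-6d). All constants (`δ`, the scale `s(ρ)`, `A`, `A₁`,
`δ₁`, `ρ' = s δ₁ / 6`) are fixed from the label and the band BEFORE the spacetime.
-/

noncomputable section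

set_option maxSynthPendingDepth 3

-- D-0017: single-problem summit, `Summit.<S>.<S>.…` by design (cf. lakefile `weak.linter.dupNamespace`).
set_option linter.dupNamespace false

namespace Summit.FinalStateConjecture.FinalStateConjecture.Theorems

open Set Function Metric
open Literature.Geometry.Lorentzian Literature.Geometry.Lorentzian.MetricCoord
open scoped Manifold ContDiff Topology ENNReal

/-- A bound on all `‖Dᵐ h(z)‖`, `m ≤ k`, `z ∈ S`, by a real `δ ≥ 0` bounds `supCkENorm S k h` by
`ENNReal.ofReal δ`. [folklore] -/
theorem ikStep_supCkENorm_le {F : Type*} [NormedAddCommGroup F] [NormedSpace ℝ F]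
    {S : Set E4} {k : ℕ} {h : E4 → F} {δ : ℝ}
    (hb : ∀ z ∈ S, ∀ m : ℕ, m ≤ k → ‖iteratedFDeriv ℝ m h z‖ ≤ δ) :
    supCkENorm S k h ≤ ENNReal.ofReal δ := by
  refine supCkENorm_le_of_forall_le fun m hm z hz ↦ ?_
  rw [← ofReal_norm]
  exact ENNReal.ofReal_le_ofReal (hb z hz m hm)

/-- **The local step of the outward sweep, from Ionescu–Klainerman's local extension theorem
(chart form, taken as the hypothesis `hIK` — the body of the skeleton's
`IKLocalKillingExtension`, Ionescu–Klainerman, JAMS 26 (2013), Thm 1.2 with Lemmas 2.10–2.11).**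
For a label `0 < M`, `|a| < M` and a band `r₊ < r_lo < r_e < r_ph⁺ = photonOrbitRadius M (−|a|)`
there is a tolerance `δ > 0`, and for every input radius `ρ > 0` an output radius `ρ' > 0`,
such that for every Ricci-flat spacetime `𝓢` and every chart `Φ : E4 → 𝓢` smooth and openly
embedded on the star domain `{r > M}` with injective differential, whose components are
`δ`-close to `g_{M,a}` in `C⁶` on `{(r₊ + r_lo)/2 ≤ r ≤ r_e + 1}`, the uniform local extension
property of `stub_kerrCoordKillingSweepSmooth` holds across every cylinder `{r = c}`,
`c ∈ [r_lo, r_e]`: a `C^∞` solution of the coordinate Killing equation on `ball x ρ ∩ {r < c}`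
(`r x = c`) extends to one on `ball x ρ'`, agreeing below the cylinder.
[cite: IonescuKlainerman2013, Thm 1.2, Lemma 2.10, Lemma 2.11] -/
theorem stub_ikLocalStep :
    (∀ (A A₁ δ₀ : ℝ), 1 ≤ A → A ≤ A₁ → 0 < δ₀ → δ₀ ≤ 1 → ∃ δ₁ : ℝ, 0 < δ₁ ∧ δ₁ ≤ δ₀ ∧
      ∀ (G : E4 → E4 →L[ℝ] E4 →L[ℝ] ℝ) (f : E4 → ℝ) (p : E4) (Z : E4 → E4),
        MetricCoord.IsMetricOn G (Metric.ball p 1) →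
        (∀ x ∈ Metric.ball p 1, MetricCoord.ricAt G x = 0) →
        G p = Minkowski.bilin →
        ContDiffOn ℝ ∞ f (Metric.ball p 1) →
        (∀ x ∈ Metric.ball p 1,
          (∑ j ∈ Finset.Icc 1 6, ‖iteratedFDeriv ℝ j G x‖) +
            (∑ j ∈ Finset.Icc 1 4, ‖iteratedFDeriv ℝ j f x‖) ≤ A) →
        f p = 0 → A₁⁻¹ ≤ ‖fderiv ℝ f p‖ →
        (∃ μ ∈ Icc (-A₁) A₁, ∀ X : E4,
          A₁⁻¹ * ‖X‖ ^ 2 ≤ μ * G p X X - MetricCoord.hessAt G f p X X + A₁ * (fderiv ℝ f p X) ^ 2) →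
        ContDiffOn ℝ ∞ Z (Metric.ball p δ₀ ∩ {x | f x < 0}) →
        (∀ x ∈ Metric.ball p δ₀ ∩ {x | f x < 0}, ∀ Y W : E4,
          fderiv ℝ G x (Z x) Y W + G x (fderiv ℝ Z x Y) W + G x Y (fderiv ℝ Z x W) = 0) →
        ∃ Z' : E4 → E4, ContDiffOn ℝ ∞ Z' (Metric.ball p δ₁) ∧
          (∀ x ∈ Metric.ball p δ₁, ∀ Y W : E4,
            fderiv ℝ G x (Z' x) Y W + G x (fderiv ℝ Z' x Y) W + G x Y (fderiv ℝ Z' x W) = 0) ∧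
          EqOn Z' Z (Metric.ball p δ₁ ∩ {x | f x < 0})) →
    ∀ (M a r_lo r_e : ℝ), 0 < M → |a| < M → Kerr.rPlus M a < r_lo → r_lo < r_e →
      r_e < Kerr.photonOrbitRadius M (-|a|) →
      ∃ δ : ℝ, 0 < δ ∧ ∀ ρ : ℝ, 0 < ρ → ∃ ρ' : ℝ, 0 < ρ' ∧
      ∀ (𝓢 : Spacetime.{0} 4) [𝓢.metric.HasLeviCivita] (Φ : E4 → 𝓢.carrier),
        𝓢.metric.toPseudoRiemannianMetric.IsRicciFlat →
        ContMDiffOn 𝓘(ℝ, E4) (𝓡 4) ∞ Φ {z | M < Kerr.radius a z} →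
        Topology.IsOpenEmbedding ({z : E4 | M < Kerr.radius a z}.restrict Φ) →
        (∀ z : E4, M < Kerr.radius a z → Function.Injective (mfderiv 𝓘(ℝ, E4) (𝓡 4) Φ z)) →
        (∀ z : E4, (Kerr.rPlus M a + r_lo) / 2 ≤ Kerr.radius a z → Kerr.radius a z ≤ r_e + 1 →
          ∀ j : ℕ, j ≤ 6 →
            ‖iteratedFDeriv ℝ j (fun z => 𝓢.metricInCoords Φ z - Kerr.bilin M a z) z‖ ≤ δ) →
        ∀ c ∈ Icc r_lo r_e, ∀ x : E4, Kerr.radius a x = c → ∀ k : E4 → E4,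
          ContDiffOn ℝ ∞ k (ball x ρ ∩ {y | Kerr.radius a y < c}) →
          (∀ y ∈ ball x ρ ∩ {y | Kerr.radius a y < c}, ∀ Y Z : E4,
            fderiv ℝ (𝓢.metricInCoords Φ) y (k y) Y Z + 𝓢.metricInCoords Φ y (fderiv ℝ k y Y) Z
              + 𝓢.metricInCoords Φ y Y (fderiv ℝ k y Z) = 0) →
          ∃ k' : E4 → E4, ContDiffOn ℝ ∞ k' (ball x ρ') ∧
            (∀ y ∈ ball x ρ', ∀ Y Z : E4,
              fderiv ℝ (𝓢.metricInCoords Φ) y (k' y) Y Z + 𝓢.metricInCoords Φ y (fderiv ℝ k' y Y) Z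
                + 𝓢.metricInCoords Φ y Y (fderiv ℝ k' y Z) = 0) ∧
            EqOn k' k (ball x ρ' ∩ {y | Kerr.radius a y < c}) := by
  intro hIK M a r_lo r_e hM ha hlo hloe hre
  -- label-level constants
  have hrpM : M ≤ Kerr.rPlus M a := le_add_of_nonneg_right (Real.sqrt_nonneg _)
  obtain ⟨δU, ε₁, hδU, hε₁, hU⟩ := stub_kerrMultiplierBelowShell M a r_lo r_e hM ha hlo hloe hre
  obtain ⟨ρ₀, L₃, ν, CK, hρ₀, hL₃, hν, hCK, hband⟩ :=
    stub_kerrBandHigherRegularity M a r_lo r_e 6 hM ha hlo hloe.le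
  obtain ⟨δF, hδF, hF⟩ := stub_ikFrameNormalisation M a hM
  set δ : ℝ := min 1 (min δU δF) with hδdef
  have hδpos : 0 < δ := lt_min one_pos (lt_min hδU hδF)
  have hδ1 : δ ≤ 1 := min_le_left _ _
  have hδU' : δ ≤ δU := (min_le_right _ _).trans (min_le_left _ _)
  have hδF' : δ ≤ δF := (min_le_right _ _).trans (min_le_right _ _)
  refine ⟨δ, hδpos, fun ρ hρ ↦ ?_⟩
  -- the scale `s`: `6 s ≤ t / 2` with `t = min (min ρ₀ (1 / (L₃ + 1))) ρ`, and `s ≤ 1 / 12`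
  set t : ℝ := min (min ρ₀ (1 / (L₃ + 1))) ρ with htdef
  have htpos : 0 < t := lt_min (lt_min hρ₀ (by positivity)) hρ
  have htρ₀ : t ≤ ρ₀ := (min_le_left _ _).trans (min_le_left _ _)
  have htL : t ≤ 1 / (L₃ + 1) := (min_le_left _ _).trans (min_le_right _ _)
  have htρ : t ≤ ρ := min_le_right _ _
  set s : ℝ := min 1 t / 12 with hsdef
  have hspos : 0 < s := by positivity
  have hs1 : s ≤ 1 := by
    have : min 1 t ≤ 1 := min_le_left _ _
    rw [hsdef]; linarith only [this]
  have hst : 12 * s ≤ t := by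
    have : min 1 t ≤ t := min_le_right _ _
    rw [hsdef]; linarith only [this]
  have hs0 : s ≠ 0 := hspos.ne'
  -- IK constants
  set A : ℝ := 1 + 6 * (6 ^ 8 * (CK + 1)) + 4 * (6 ^ 4 * CK) / s with hAdef
  have hA1 : 1 ≤ A := by
    have h1 : 0 ≤ 6 * (6 ^ 8 * (CK + 1)) := by positivity
    have h2 : 0 ≤ 4 * (6 ^ 4 * CK) / s := by positivity
    rw [hAdef]; linarith only [h1, h2]
  set A₁ : ℝ := max A (max (36 * ε₁⁻¹ ^ 2) (max ε₁⁻¹ (6 / ν))) with hA₁def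
  have hAA₁ : A ≤ A₁ := le_max_left _ _
  have hA₁pos : 0 < A₁ := lt_of_lt_of_le (lt_of_lt_of_le one_pos hA1) hAA₁
  have hA₁ε2 : 36 * ε₁⁻¹ ^ 2 ≤ A₁ := (le_max_left _ _).trans (le_max_right _ _)
  have hA₁ε : ε₁⁻¹ ≤ A₁ := ((le_max_left _ _).trans (le_max_right _ _)).trans (le_max_right _ _)
  have hA₁ν : 6 / ν ≤ A₁ := ((le_max_right _ _).trans (le_max_right _ _)).trans (le_max_right _ _)
  obtain ⟨δ₁, hδ₁, hδ₁1, hIK'⟩ := hIK A A₁ 1 hA1 hAA₁ one_pos le_rfl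
  refine ⟨s * δ₁ / 6, by positivity, ?_⟩
  intro 𝓢 _ Φ hRF hΦ hemb hinjd hclose c hc x hx k hk hkeq
  -- the chart components as a metric datum on the star domain `W = {r > M}`
  set G : E4 → E4 →L[ℝ] E4 →L[ℝ] ℝ := 𝓢.metricInCoords Φ with hGdef
  set W : Set E4 := {z | M < Kerr.radius a z} with hWdef
  have hW : IsOpen W := isOpen_lt continuous_const (Kerr.continuous_radius a)
  have hGmet : IsMetricOn G W := stub_isMetricOn_metricInCoords 𝓢 Φ W hW hΦ hinjd
  have hGsm : ContDiffOn ℝ ∞ G W := hGmet.contDiffOn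
  have hric : ∀ z ∈ W, ricAt G z = 0 := fun z hz ↦
    killingLoc_ricAt_metricInCoords_eq_zero 𝓢 Φ W hW hΦ hinjd hRF hz
  -- the point `x` on the cylinder `{r = c}`
  have hxlo : r_lo ≤ Kerr.radius a x := hx ▸ hc.1
  have hxe : Kerr.radius a x ≤ r_e := hx ▸ hc.2
  have hxM : M < Kerr.radius a x := by linarith only [hrpM, hlo, hxlo]
  have hxW : x ∈ W := hxM
  have hx0 : 0 < Kerr.radius a x := hM.trans hxM
  -- the exact frame at `x`
  have hGx_close : ‖G x - Kerr.bilin M a x‖ ≤ δF := by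
    have h := hclose x (by linarith only [hlo, hxlo]) (by linarith only [hxe]) 0 (Nat.zero_le _)
    rw [norm_iteratedFDeriv_zero] at h
    exact h.trans hδF'
  obtain ⟨L, hL, hL6, hLs6⟩ := hF (G x) x hxM (fun v w ↦ 𝓢.metricInCoords_symm Φ x v w) hGx_close
  obtain ⟨Ls, hLs, hLss⟩ := ikStep_exists_smul_equiv L hs0
  have hLs_apply : ∀ v : E4, Ls v = s • L v := fun v ↦ by
    simpa using DFunLike.congr_fun hLs v
  have hLss_apply : ∀ v : E4, Ls.symm v = s⁻¹ • L.symm v := fun v ↦ by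
    simpa using DFunLike.congr_fun hLss v
  have hnLs : ‖(Ls : E4 →L[ℝ] E4)‖ ≤ 6 * s := by
    rw [hLs, norm_smul, Real.norm_eq_abs, abs_of_pos hspos]
    calc s * ‖(L : E4 →L[ℝ] E4)‖ ≤ s * 6 := mul_le_mul_of_nonneg_left hL6 hspos.le
      _ = 6 * s := by ring
  have hnLss : ‖(Ls.symm : E4 →L[ℝ] E4)‖ ≤ 6 / s := by
    rw [hLss, norm_smul, Real.norm_eq_abs, abs_of_pos (inv_pos.2 hspos), div_eq_inv_mul]
    exact mul_le_mul_of_nonneg_left hLs6 (inv_pos.2 hspos).le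
  -- the affine chart `aff y = x + Ls y` and the tube facts at its points
  have htube : ∀ y : E4, ‖y‖ ≤ 1 →
      x + Ls y ∈ ball x ρ ∧
      (Kerr.rPlus M a + r_lo) / 2 < Kerr.radius a (x + Ls y) ∧
      Kerr.radius a (x + Ls y) ≤ r_e + 1 ∧
      x + Ls y ∈ W ∧ 0 < Kerr.radius a (x + Ls y) ∧
      ContDiffAt ℝ ∞ (Kerr.bilin M a) (x + Ls y) ∧ ContDiffAt ℝ ∞ (Kerr.radius a) (x + Ls y) ∧
      ν ≤ ‖fderiv ℝ (Kerr.radius a) (x + Ls y)‖ ∧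
      (∀ j : ℕ, j ≤ 6 → ‖iteratedFDeriv ℝ j (Kerr.bilin M a) (x + Ls y)‖ ≤ CK ∧
        ‖iteratedFDeriv ℝ j (Kerr.radius a) (x + Ls y)‖ ≤ CK) ∧
      (∀ j : ℕ, j ≤ 6 → ‖iteratedFDeriv ℝ j G (x + Ls y)‖ ≤ CK + 1) := by
    intro y hy
    have hw : ‖Ls y‖ ≤ 6 * s := by
      calc ‖Ls y‖ ≤ ‖(Ls : E4 →L[ℝ] E4)‖ * ‖y‖ := (Ls : E4 →L[ℝ] E4).le_opNorm y
        _ ≤ 6 * s * 1 := by gcongr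
        _ = 6 * s := by ring
    have hwt : ‖Ls y‖ ≤ t / 2 := by linarith only [hw, hst]
    have hwρ₀ : ‖Ls y‖ ≤ ρ₀ := by linarith only [hwt, htρ₀, htpos]
    obtain ⟨hr1, hr2, hKs, hrs, hνy, hjb⟩ := hband x hxlo hxe (Ls y) hwρ₀
    have hball : x + Ls y ∈ ball x ρ := by
      rw [mem_ball, dist_eq_norm, add_sub_cancel_left]; linarith only [hwt, htρ, htpos]
    have hre1 : Kerr.radius a (x + Ls y) ≤ r_e + 1 := by
      have h1 : L₃ * ‖Ls y‖ ≤ L₃ * (1 / (L₃ + 1)) :=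
        mul_le_mul_of_nonneg_left (by linarith only [hwt, htL, htpos]) hL₃
      have h2 : L₃ * (1 / (L₃ + 1)) ≤ 1 := by
        rw [mul_one_div, div_le_one (by linarith only [hL₃])]; linarith only [hL₃]
      have h3 := (abs_le.1 hr2).2
      linarith only [h1, h2, h3, hxe]
    have hWy : x + Ls y ∈ W := by
      show M < Kerr.radius a (x + Ls y); linarith only [hr1, hrpM, hlo]
    have hr0y : 0 < Kerr.radius a (x + Ls y) := hM.trans hWy
    refine ⟨hball, hr1, hre1, hWy, hr0y, hKs, hrs, hνy, fun j hj ↦ hjb j hj, fun j hj ↦ ?_⟩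
    -- `‖Dʲ G‖ ≤ ‖Dʲ g_{M,a}‖ + ‖Dʲ (G - g_{M,a})‖ ≤ CK + δ ≤ CK + 1`
    have hGa : ContDiffAt ℝ j G (x + Ls y) :=
      ((hGsm _ hWy).contDiffAt (hW.mem_nhds hWy)).of_le (by exact_mod_cast le_top)
    have hKa : ContDiffAt ℝ j (Kerr.bilin M a) (x + Ls y) := hKs.of_le (by exact_mod_cast le_top)
    have hDa : ContDiffAt ℝ j (fun z => G z - Kerr.bilin M a z) (x + Ls y) := hGa.sub hKa
    have hsplit : iteratedFDeriv ℝ j G (x + Ls y) =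
        iteratedFDeriv ℝ j (Kerr.bilin M a) (x + Ls y) +
          iteratedFDeriv ℝ j (fun z => G z - Kerr.bilin M a z) (x + Ls y) := by
      rw [← iteratedFDeriv_add_apply hKa hDa]
      congr 1
      funext z
      simp only [Pi.add_apply, add_sub_cancel]
    rw [hsplit]
    calc ‖iteratedFDeriv ℝ j (Kerr.bilin M a) (x + Ls y) +
          iteratedFDeriv ℝ j (fun z => G z - Kerr.bilin M a z) (x + Ls y)‖
        ≤ ‖iteratedFDeriv ℝ j (Kerr.bilin M a) (x + Ls y)‖ +
          ‖iteratedFDeriv ℝ j (fun z => G z - Kerr.bilin M a z) (x + Ls y)‖ := norm_add_le _ _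
      _ ≤ CK + δ := add_le_add (hjb j hj).1 (hclose _ hr1.le hre1 j hj)
      _ ≤ CK + 1 := by linarith only [hδ1]
  have haff0 : x + Ls 0 = x := by simp
  have hmem1 : ∀ y : E4, y ∈ ball (0 : E4) 1 → ‖y‖ ≤ 1 := fun y hy ↦ (mem_ball_zero_iff.1 hy).le
  -- the multiplier form of IK JAMS 2013 Lemma 2.11 (a) at `x`
  have hsup : supCkENorm {z | M < Kerr.radius a z ∧ r_lo ≤ Kerr.radius a z ∧ Kerr.radius a z ≤ r_e} 2
      (fun z => G z - Kerr.bilin M a z) ≤ ENNReal.ofReal δU := by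
    refine ikStep_supCkENorm_le fun z hz m hm ↦ ?_
    exact (hclose z (by linarith only [hz.2.1, hlo]) (by linarith only [hz.2.2]) m (by omega)).trans hδU'
  obtain ⟨μ₀, hμ₀, hUin⟩ := hU 𝓢 Φ hΦ hemb hsup x hxlo hxe
  -- the normalised data (opaque names with defining equations)
  obtain ⟨Gt, hGt⟩ : ∃ Gt : E4 → E4 →L[ℝ] E4 →L[ℝ] ℝ, ∀ y : E4, Gt y =
      (s ^ 2)⁻¹ • (G (x + Ls y)).bilinearComp (Ls : E4 →L[ℝ] E4) (Ls : E4 →L[ℝ] E4) :=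
    ⟨_, fun _ ↦ rfl⟩
  obtain ⟨ft, hft⟩ : ∃ ft : E4 → ℝ, ∀ y : E4, ft y = (s ^ 2)⁻¹ * (Kerr.radius a (x + Ls y) - c) :=
    ⟨_, fun _ ↦ rfl⟩
  obtain ⟨kt, hkt⟩ : ∃ kt : E4 → E4, ∀ y : E4, kt y = (Ls.symm : E4 →L[ℝ] E4) (k (x + Ls y)) :=
    ⟨_, fun _ ↦ rfl⟩
  -- IK's hypotheses at `p = 0`
  obtain ⟨hGtmetW, hGtricW, hGt0, -, -⟩ := ikStep_Gt_basic hGmet hric hspos hLs_apply hL hGt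
  have hball_sub : ball (0 : E4) 1 ⊆ (fun y : E4 => x + Ls y) ⁻¹' W := fun y hy ↦
    (htube y (hmem1 y hy)).2.2.2.1
  have hGtmet : IsMetricOn Gt (ball 0 1) := ikStep_isMetricOn_mono hGtmetW isOpen_ball hball_sub
  have hGtric : ∀ y ∈ ball (0 : E4) 1, ricAt Gt y = 0 := fun y hy ↦ hGtricW y (hball_sub hy)
  have hr0x : ContDiffAt ℝ ∞ (Kerr.radius a) x := by
    have h := (htube 0 (by simp)).2.2.2.2.2.2.1
    rwa [haff0] at h
  have hνx : ν ≤ ‖fderiv ℝ (Kerr.radius a) x‖ := by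
    have h := (htube 0 (by simp)).2.2.2.2.2.2.2.1
    rwa [haff0] at h
  obtain ⟨hft0, -, -, hftcd⟩ := ikStep_ft_basic hspos hLs_apply hx hft hr0x
  have hft_cd : ContDiffOn ℝ ∞ ft (ball 0 1) := fun y hy ↦
    (hftcd y (htube y (hmem1 y hy)).2.2.2.2.2.2.1).contDiffWithinAt
  have hAbound : ∀ y ∈ ball (0 : E4) 1,
      (∑ j ∈ Finset.Icc 1 6, ‖iteratedFDeriv ℝ j Gt y‖) +
        (∑ j ∈ Finset.Icc 1 4, ‖iteratedFDeriv ℝ j ft y‖) ≤ A := by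
    intro y hy
    obtain ⟨-, -, -, hyW, hr0y, -, -, -, hjb, hjG⟩ := htube y (hmem1 y hy)
    have h := ikStep_bound_A hGmet hspos hs1 hLs hL6 hGt hft hCK hyW hr0y (fun j hj ↦ (hjb j hj).2) hjG
    rw [hAdef]; linarith only [h]
  obtain ⟨hft_norm, hq6⟩ := stub_ikQuant6 G W a c s x L Ls Gt ft ν ε₁ μ₀ A₁ hGmet hric hxW hspos hs1
    hLs_apply hL hLs6 hGt hx hft hr0x hν hε₁ hA₁pos hνx hμ₀ hUin hA₁ε2 hA₁ε hA₁ν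
  obtain ⟨hkt_cd, hkt_eq⟩ := ikStep_kt_input hGmet hspos hGt hft hk hkeq
    (fun y hy ↦ ⟨(htube y hy).1, (htube y hy).2.2.2.1⟩) hkt
  -- Ionescu–Klainerman at the origin of the normalised chart
  obtain ⟨Z', hZ'cd, hZ'eq, hZ'agree⟩ :=
    hIK' Gt ft 0 kt hGtmet hGtric hGt0 hft_cd hAbound hft0 hft_norm hq6 hkt_cd hkt_eq
  -- back to the chart `Φ`
  obtain ⟨k', hk'⟩ : ∃ k' : E4 → E4, ∀ y' : E4,
      k' y' = Ls (Z' ((Ls.symm : E4 →L[ℝ] E4) (y' - x))) := ⟨_, fun _ ↦ rfl⟩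
  obtain ⟨h1, h2, h3⟩ := stub_ikKillingBack G W a c s x L Ls Gt ft k kt Z' k' δ₁ hGmet hspos hLss hLs6
    hGt hft (fun y hy ↦ (htube y hy).2.2.2.1) hkt hδ₁1 hZ'cd hZ'eq hZ'agree hk'
  exact ⟨k', h1, h2, h3⟩

end Summit.FinalStateConjecture.FinalStateConjecture.Theorems

end
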